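import Literature.Topology.PlanarFoliations.Reverse
import HarnessLib

/-!
# Changing the base point of an open leaf: the order, the half-leaves and the limit sets agree

Topic: Topology / PlanarFoliations, sequel to `LeafOrder.lean` (the linear order `leafLT hbi` of
an open leaf `F.Leaf x`, read in the line charts of the base point `x`), `OmegaLimit.lean`
(`fwd`, `omegaSet`), `Reverse.lean` (`bwd`, `alphaSet`). For `x' ∈ F.leaf x` the leaves
`F.Leaf x'` and `F.Leaf x` have the same points (`Leaf.rebase`, a homeomorphism over the identity
of `X`), and **the two leaf orders agree** (`leafLT_rebase_iff`): locally both are read by the leaf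
coordinate of any flow box (`leafArc_lt_iff`), and an open forward ray of `F.Leaf x'` is
connected, so its image misses the base point's image on one side. Hence the forward and backward
half-leaves, **the ω-limit set and the α-limit set do not depend on the base point**
(`rebase_mem_fwd_iff`, `omegaSet_eq_of_mem_leaf`, `alphaSet_eq_of_mem_leaf`).

All statements are [folklore].
-/

noncomputable section

open Set Filter Function
open _root_.Topology
open Literature.Topology.FourManifolds Literature.Topology.FourManifolds.Foliation

namespace Literature.Topology.PlanarFoliations

variable {X : Type*} [TopologicalSpace X] [T2Space X] [SecondCountableTopology X] {F : Foliation ℝ X} {x x' : X}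

/-! ## The identity between the two copies of a leaf -/

namespace Leaf

omit [T2Space X] [SecondCountableTopology X] in
/-- A point of the leaf of `x'`, for `x' ∈ F.leaf x`, is a point of the leaf of `x`. [folklore] -/
theorem pt_mem_of_mem (hx' : x' ∈ F.leaf x) (p : F.Leaf x') : Leaf.pt p ∈ F.leaf x := by
  rw [← leaf_eq_of_mem hx']; exact p.2

omit [T2Space X] [SecondCountableTopology X] in
/-- A point of the leaf of `x`, for `x' ∈ F.leaf x`, is a point of the leaf of `x'`. [folklore] -/
theorem pt_mem_of_mem' (hx' : x' ∈ F.leaf x) (p : F.Leaf x) : Leaf.pt p ∈ F.leaf x' := by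
  rw [leaf_eq_of_mem hx']; exact p.2

/-- **Rebasing**: the identity of points from the leaf of `x'` to the leaf of `x`, for
`x' ∈ F.leaf x`, a homeomorphism of the leaf topologies. [folklore] -/
def rebase (hx' : x' ∈ F.leaf x) : F.Leaf x' ≃ₜ F.Leaf x where
  toFun p := Leaf.mk (Leaf.pt p) (pt_mem_of_mem hx' p)
  invFun p := Leaf.mk (Leaf.pt p) (pt_mem_of_mem' hx' p)
  left_inv _ := rfl
  right_inv _ := rfl
  continuous_toFun := Continuous.subtype_mk continuous_subtype_val _
  continuous_invFun := Continuous.subtype_mk continuous_subtype_val _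

omit [T2Space X] [SecondCountableTopology X] in
/-- Rebasing is the identity on points. [folklore] -/
@[simp] theorem pt_rebase (hx' : x' ∈ F.leaf x) (p : F.Leaf x') : Leaf.pt (rebase hx' p) = Leaf.pt p := rfl

omit [T2Space X] [SecondCountableTopology X] in
/-- Rebasing is the identity on points of the leaf space. [folklore] -/
@[simp] theorem coe_rebase (hx' : x' ∈ F.leaf x) (p : F.Leaf x') : ((rebase hx' p : F.Leaf x) : F.LeafSpace) = p := rfl

end Leaf

/-! ## The two orders agree -/

section Order

variable [NoncompactSpace (F.Leaf x)] [NoncompactSpace (F.Leaf x')] {hbi : IsBiOriented F}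

/-- **The orders agree near every point.** [folklore] -/
theorem eventually_leafLT_rebase_iff (hx' : x' ∈ F.leaf x) (p : F.Leaf x') :
    ∀ᶠ q in 𝓝 p, (leafLT hbi p q ↔ leafLT hbi (Leaf.rebase hx' p) (Leaf.rebase hx' q)) ∧
      (leafLT hbi q p ↔ leafLT hbi (Leaf.rebase hx' q) (Leaf.rebase hx' p)) := by
  -- a leaf arc around `p`, for both base points
  obtain ⟨e, he, t, h', hp'⟩ := exists_mem_leafArc_source p
  have h : plaque e t ⊆ F.leaf x := by rw [← leaf_eq_of_mem hx']; exact h'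
  have hsrc : ∀ {q : F.Leaf x'}, q ∈ (leafArc e t h' he).source → Leaf.rebase hx' q ∈ (leafArc e t h he).source := by
    intro q hq
    rw [mem_leafArc_source_iff] at hq ⊢
    exact hq
  have hval : ∀ {q : F.Leaf x'}, q ∈ (leafArc e t h' he).source → leafArc e t h he (Leaf.rebase hx' q) = leafArc e t h' he q := by
    intro q hq
    rw [leafArc_apply h he (hsrc hq), leafArc_apply h' he hq]
    rfl
  have hopen : ∀ᶠ q in 𝓝 p, q ∈ (leafArc e t h' he).source := (isOpen_leafArc_source h' he).mem_nhds hp'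
  refine hopen.mono fun q hq ↦ ⟨?_, ?_⟩
  · rw [← leafArc_lt_iff he h' hp' hq, ← leafArc_lt_iff he h (hsrc hp') (hsrc hq), hval hp', hval hq]
  · rw [← leafArc_lt_iff he h' hq hp', ← leafArc_lt_iff he h (hsrc hq) (hsrc hp'), hval hp', hval hq]

omit [NoncompactSpace (F.Leaf x')] in
/-- **Open forward rays are connected.** [folklore] -/
theorem isPreconnected_setOf_leafLT (p : F.Leaf x) : IsPreconnected {q | leafLT hbi p q} := by
  refine isPreconnected_of_forall_pair fun a ha b hb ↦ ?_
  -- the closed interval between `a` and `b` lies in the ray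
  have key : ∀ {a b : F.Leaf x}, leafLT hbi p a → leafLT hbi p b → ¬ leafLT hbi b a →
      ∃ t ⊆ {q | leafLT hbi p q}, a ∈ t ∧ b ∈ t ∧ IsPreconnected t := fun {a b} ha hb hab ↦
    ⟨leafIcc hbi a b, fun r hr ↦ by
      rcases not_leafLT_iff.1 hr.1 with h | h
      · exact leafLT_trans ha h
      · exact h ▸ ha, left_mem_leafIcc hab, right_mem_leafIcc hab, isPreconnected_leafIcc a b⟩
  rcases leafLT_trichotomy (hbi := hbi) a b with h | h | h
  · exact key ha hb (leafLT_asymm h)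
  · subst h; exact key ha ha (leafLT_irrefl _)
  · obtain ⟨t, ht, hbt, hat, htc⟩ := key hb ha (leafLT_asymm h)
    exact ⟨t, ht, hat, hbt, htc⟩

/-- **The two leaf orders agree** (forward direction). [folklore] -/
theorem leafLT_rebase (hx' : x' ∈ F.leaf x) {p q : F.Leaf x'} (hpq : leafLT hbi p q) :
    leafLT hbi (Leaf.rebase hx' p) (Leaf.rebase hx' q) := by
  set Φ := Leaf.rebase (F := F) hx' with hΦ
  set A : Set (F.Leaf x') := {q | leafLT hbi p q} with hA
  -- the image of the ray is connected and misses `Φ p`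
  have hAc : IsPreconnected (Φ '' A) := (isPreconnected_setOf_leafLT p).image _ Φ.continuous.continuousOn
  have hmiss : Φ p ∉ Φ '' A := by
    rintro ⟨q, hq, hqp⟩
    have : q = p := Φ.injective hqp
    subst this
    exact leafLT_irrefl _ hq
  have hcover : Φ '' A ⊆ {r | leafLT hbi (Φ p) r} ∪ {r | leafLT hbi r (Φ p)} := by
    intro r hr
    rcases leafLT_trichotomy (hbi := hbi) (Φ p) r with h | h | h
    · exact Or.inl h
    · subst h; exact absurd hr hmiss
    · exact Or.inr h
  have hdisj : Disjoint {r | leafLT hbi (Φ p) r} {r : F.Leaf x | leafLT hbi r (Φ p)} :=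
    disjoint_left.2 fun r h₁ h₂ ↦ leafLT_asymm h₁ h₂
  -- some points of the ray just after `p` are mapped after `Φ p`
  obtain ⟨q₀, hq₀A, hq₀⟩ : ∃ q₀ ∈ A, leafLT hbi (Φ p) (Φ q₀) := by
    have h := (frequently_leafLT_right (hbi := hbi) p).and_eventually (eventually_leafLT_rebase_iff (hbi := hbi) hx' p)
    obtain ⟨q₀, hq₀, hiff⟩ := h.exists
    exact ⟨q₀, hq₀, hiff.1.1 hq₀⟩
  rcases hAc.subset_or_subset (isOpen_setOf_leafLT_right _) (isOpen_setOf_leafLT_left _) hdisj hcover with hsub | hsub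
  · exact hsub ⟨q, hpq, rfl⟩
  · exact absurd (hsub ⟨q₀, hq₀A, rfl⟩) (leafLT_asymm hq₀)

/-- **The two leaf orders agree.** [folklore] -/
theorem leafLT_rebase_iff (hx' : x' ∈ F.leaf x) {p q : F.Leaf x'} :
    leafLT hbi (Leaf.rebase hx' p) (Leaf.rebase hx' q) ↔ leafLT hbi p q := by
  refine ⟨fun h ↦ ?_, leafLT_rebase hx'⟩
  rcases leafLT_trichotomy (hbi := hbi) p q with h' | h' | h'
  · exact h'
  · subst h'; exact absurd h (leafLT_irrefl _)
  · exact absurd (leafLT_rebase hx' h') (leafLT_asymm h)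

/-- **Forward half-leaves agree.** [folklore] -/
theorem rebase_mem_fwd_iff (hx' : x' ∈ F.leaf x) {p q : F.Leaf x'} :
    Leaf.rebase hx' q ∈ fwd hbi (Leaf.rebase hx' p) ↔ q ∈ fwd hbi p := by
  show ¬ _ ↔ ¬ _
  rw [leafLT_rebase_iff hx']

/-- **Backward half-leaves agree.** [folklore] -/
theorem rebase_mem_bwd_iff (hx' : x' ∈ F.leaf x) {p q : F.Leaf x'} :
    Leaf.rebase hx' q ∈ bwd hbi (Leaf.rebase hx' p) ↔ q ∈ bwd hbi p := by
  show ¬ _ ↔ ¬ _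
  rw [leafLT_rebase_iff hx']

/-- The image of a forward half-leaf does not depend on the base point. [folklore] -/
theorem image_fwd_rebase {ι : X → ℂ} (hx' : x' ∈ F.leaf x) (p : F.Leaf x') :
    (fun q : F.Leaf x ↦ ι (Leaf.pt q)) '' fwd hbi (Leaf.rebase hx' p) = (fun q : F.Leaf x' ↦ ι (Leaf.pt q)) '' fwd hbi p := by
  ext z
  constructor
  · rintro ⟨r, hr, rfl⟩
    refine ⟨(Leaf.rebase hx').symm r, ?_, ?_⟩
    · rw [← rebase_mem_fwd_iff hx', Homeomorph.apply_symm_apply]; exact hr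
    · show ι (Leaf.pt (Leaf.rebase hx' ((Leaf.rebase hx').symm r))) = ι (Leaf.pt r)
      rw [Homeomorph.apply_symm_apply]
  · rintro ⟨q, hq, rfl⟩
    exact ⟨Leaf.rebase hx' q, (rebase_mem_fwd_iff hx').2 hq, rfl⟩

/-- The image of a backward half-leaf does not depend on the base point. [folklore] -/
theorem image_bwd_rebase {ι : X → ℂ} (hx' : x' ∈ F.leaf x) (p : F.Leaf x') :
    (fun q : F.Leaf x ↦ ι (Leaf.pt q)) '' bwd hbi (Leaf.rebase hx' p) = (fun q : F.Leaf x' ↦ ι (Leaf.pt q)) '' bwd hbi p := by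
  ext z
  constructor
  · rintro ⟨r, hr, rfl⟩
    refine ⟨(Leaf.rebase hx').symm r, ?_, ?_⟩
    · rw [← rebase_mem_bwd_iff hx', Homeomorph.apply_symm_apply]; exact hr
    · show ι (Leaf.pt (Leaf.rebase hx' ((Leaf.rebase hx').symm r))) = ι (Leaf.pt r)
      rw [Homeomorph.apply_symm_apply]
  · rintro ⟨q, hq, rfl⟩
    exact ⟨Leaf.rebase hx' q, (rebase_mem_bwd_iff hx').2 hq, rfl⟩

/-- **The ω-limit set does not depend on the base point.** [folklore] -/
theorem omegaSet_eq_of_mem_leaf {ι : X → ℂ} (hx' : x' ∈ F.leaf x) : omegaSet hbi ι x' = omegaSet hbi ι x := by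
  apply Subset.antisymm
  · intro z hz
    refine mem_omegaSet_iff.2 fun p ↦ ?_
    have h := mem_omegaSet_iff.1 hz ((Leaf.rebase hx').symm p)
    rwa [← image_fwd_rebase hx', Homeomorph.apply_symm_apply] at h
  · intro z hz
    refine mem_omegaSet_iff.2 fun p ↦ ?_
    have h := mem_omegaSet_iff.1 hz (Leaf.rebase hx' p)
    rwa [image_fwd_rebase hx'] at h

/-- **The α-limit set does not depend on the base point.** [folklore] -/
theorem alphaSet_eq_of_mem_leaf {ι : X → ℂ} (hx' : x' ∈ F.leaf x) : alphaSet hbi ι x' = alphaSet hbi ι x := by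
  apply Subset.antisymm
  · intro z hz
    refine mem_alphaSet_iff.2 fun p ↦ ?_
    have h := mem_alphaSet_iff.1 hz ((Leaf.rebase hx').symm p)
    rwa [← image_bwd_rebase hx', Homeomorph.apply_symm_apply] at h
  · intro z hz
    refine mem_alphaSet_iff.2 fun p ↦ ?_
    have h := mem_alphaSet_iff.1 hz (Leaf.rebase hx' p)
    rwa [image_bwd_rebase hx'] at h

/-- **Closed leaf intervals do not depend on the base point.** [folklore] -/
theorem rebase_mem_leafIcc_iff (hx' : x' ∈ F.leaf x) {a b q : F.Leaf x'} :
    Leaf.rebase hx' q ∈ leafIcc hbi (Leaf.rebase hx' a) (Leaf.rebase hx' b) ↔ q ∈ leafIcc hbi a b := by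
  show ¬ _ ∧ ¬ _ ↔ ¬ _ ∧ ¬ _
  rw [leafLT_rebase_iff hx', leafLT_rebase_iff hx']

end Order

end Literature.Topology.PlanarFoliations
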